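import Literature.MathematicalPhysics.QuantumFieldTheory.Balaban1983to89.Node00.BgSchemeOfRecordProp4
import Literature.MathematicalPhysics.QuantumFieldTheory.Balaban1983to89.B11Eq118RegimeRadiiUniform
import Summits.QuantumFields.YangMills.Theorems.BalabanUVNodesProp4V0AtRecord
import Summits.QuantumFields.YangMills.Theorems.BalabanUVNodesN07DeltaPiOfRecordPairing
import HarnessLib

/-!
# (R2) — THE DOOR TO node00-def-Y's TARGET `Prop4UniformAtRecord` ([B11] PROP. 4 (97)–(98) FOR THE RECORD'S REMAINDER CURRENT `W = WOfRecordAt …`): the letters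
# (ℓc) SYMMETRY, (ℓb) V₀, (ρ), (τ) and the SCALARS discharged, `(εC, R′, C₄)` in CLOSED FORM — what stays displayed is exactly (ℓa-H) `‖H₁♭‖ ≤ b`, (ℓa-C) `Prop4Hyp C^{sl}`,
# (ℓd) the kernel columns, print's small-field window and the level-weight profile

Cell `pub-ymgap` ∕ `ym-nodeO-ideate`, porter lineage `ymgap-nodeO-port-PTB-1` (gen 6) on director-ym №557's (R2)-UNIFORM PORTER hand: «[B11] Prop. 4 pp.291–293 (98)
`QuadAnalytic (WOfRecordAt …) C₄ a₃` with `C₄, a₃` UNIFORM in k∕volume over ✓`WOfRecordAt_eq`, [B9] inputs DISPLAYED as hypothesis letters (J5′), landing `--supports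
stmt-QuantumFields-27238 --as helper`».  Co-typed with node00-def-Y g37: the TARGET and the named letters are ✓`Node00/BgSchemeOfRecordProp4.lean` («(R2) TARGET TYPED
03d1e8860fe95e4c», my CO-TYPE ANSWER nodeO STATUS 2026-08-31T10:50:05Z folded); this file is THE HAND's complement keyed to those names (no duplicate of def-Y's glue
`prop4UniformAtRecord_of_letters(_of_norm_J_le)`, which it consumes).  File 2 of the hand, ✓`…BalabanUVNodesProp4V0AtRecord` (p821383), supplies (ℓb), (ρ), (τ).
[B11] = [Balaban1985Variational]; [B9] = [Balaban1985BackgroundPropagators]; [B7] = [Balaban1985Averaging].  Count-neutral.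

WHAT IS PROVED (0 def, 0 sorry, axioms standard; ns `Summit.QuantumFields.YangMills.Theorems.Prop4UniformAtRecord`).
* §1 GENERIC `c4OfLetters_le_of_bounds` — def-Y's constant `c4OfLetters ρ τ …` (lit ✓`quadAnalytic_W80_composite`'s polynomial, carrying `‖ρ‖‖τ‖`) is dominated by the same
  polynomial in displayed pointwise bounds `Mρ, Mτ` of the slot maps (the operator norm `‖rhoRec N‖` is not writable at the record — instance diamond between the strong topology
  in `rhoRec`'s type and Mathlib's non-reducible `l2OpNormedAddCommGroupAux` — whence the pointwise idiom).
* §2 AT THE RECORD: ★`prop4LetterSymmAtRecord_holds` — (ℓc) OUTRIGHT, every background, any `G′` (✓N07 `DeltaPiCurOfRecord_pairSum_comm`, `η^d` cancelled);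
  ★`prop4LetterV0AtRecord_of_window` — (ℓb) `Prop4LetterV0AtRecord F N K k Ω U₀ CV (1∕16)` with `CV = 1024(d−1)(ωΩ)³N(αω² + 1∕16) + (d−1)(ωΩ)³(136 + 2ωΩ)N` from the small-field
  window `‖U₀(∂p) − 1‖ ≤ αη²` and the weight profile `(ω, Ω)` (✓`Prop4V0AtRecord.curV0AtRecord_quadBound`: τ-homogeneity rescaling of lit's lattice-uniform V₀ bound, `‖tr‖ ≤ N`,
  `ρ` a contraction, `SU(N) ⊂ U1`); ★`prop4LetterNum_explicit` — the scalar letter at `εC = aC := r = min (c₄∕4) (min ½ (1∕(16(bC₂+1))))`, `R′ := min r ((1 − 4bC₂(r+r))·RV)`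
  (✓`B11Eq118RegimeRadiiUniform.regime_explicit`); ★`c4OfRecord_le_numeric` — `c4OfRecord N nJ … ≤` the same polynomial with `‖ρ‖‖τ‖ ↦ 1·N` (✓`norm_rhoRec_apply_le`,
  ✓`norm_tauRecCLM_le`).
* §3 ★★★`prop4UniformAtRecord_of_recordLetters` — THE DOOR: (ℓa-H) → (ℓa-C) → window∕profile → (ℓd) (at `εC := r`, radius `R′`, `RV := 1∕16`) → `‖J‖ ≤ nJ` →
  `Prop4UniformAtRecord F N K k Ω U₀ levB a hpos hQ r Gp (c4OfRecord N nJ b C₂ r r CV R′ θ₃ θE θE′ N₁) R′`; ★★★`prop4UniformAtRecord_of_recordLetters_numeric` — the same with the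
  purely numeric constant `Nθ₃nJ + (N₁C₂ℓ² + NθE′) + NθE·N₁C₂ℓ²·R′ + N(1 + θER′)CVℓ²` (`ℓ = (1 − 4bC₂(r+r))⁻¹`): `(εC, R′, C₄)` are CLOSED TERMS in `N, d, b, C₂, c₄, α, ω, Ω, θ₃,
  θE, θE′, N₁, nJ` — print's «The constants a₃, C₄ depend on d and L only» AS A PROVENANCE STATEMENT, given k-free displayed letters.
* §4 (APPENDED, same gen) ★★★`prop4UniformAtRecord_of_recordLetters_window` — the numeric door with `nJ := C₁B₃ε₁` supplied by print's (14) current window read bondwise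
  (lit `InU2cur … (unitsOfRecord F N U₀)`, ✓`Node00.norm_JOfRecordAtBg_le`): the antecedent is (ℓa-H), (ℓa-C), (ℓd) + print's DOMAIN clauses + the weight profile only.

THE LETTERS OF def-Y's TARGET, STATUS AFTER THIS FILE.  DISCHARGED: `Prop4LetterSymmAtRecord` (outright); `Prop4LetterV0AtRecord` (modulo print's domain clause — the plaquette
window on lit's bonds `plaqHolU (unitsOfRecord F N U₀)` — and the level-weight profile letters `ω ≥ w̄(levWeight … (bondLevLit F Ω k) 1)`, `Ω ≥ w̲⁻¹(… 1), w̲⁻¹(levWeight … (pairLevLit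
F Ω k) 2)`, k-free by the profile's provenance exactly as lit ✓`curV0_quadBound_lattice_uniform` displays them); `Prop4LetterNum` (closed form); the `‖J‖ ↦ nJ` and `‖ρ‖‖τ‖ ↦ N`
majorants (`nJ := C₁B₃ε₁` by ✓`Node00.norm_JOfRecordAtBg_le` under the (14) window `InU2cur`).  DISPLAYED (discharged by nobody here): `Prop4LetterHAtRecord … b` = (ℓa-H) (46)∕(117),
[B9] Thm 3.13 class — the (R1)∕N07 row; `Prop4LetterCAtRecord … C₂ c₄` = (ℓa-C) (44) + Sect. G radius for `CslOfRecord` (✓3e′ `BgConstraintOfRecord` HONEST (1): no (44) constant in the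
tree; lit's k-free analogue ✓`B11Eq44CLetterTower.quadAnalytic_Cck` is a MODEL-carrier statement — a record port is a separate L hand); `Prop4LetterColumnsAtRecord …` = (ℓd) the
kernel-column letters `N₁, θE, θE′, θ₃` ([B9] (3.132), [B11] (55), (73); lit's k-free suppliers `B11Ineq88KernelLettersCompositeLatticeFree` ∕ `B11Eq88LaplaceH1CurrentNorm` are
MODEL-tower statements — record ports are (R1)-class).

HONEST FRAMING.  An assembly over def-Y's glue, lit's (98) theorem and file 2; nothing of [B11] (44), (46)∕(117), (55), (73), (90)–(96) or [B9] (3.132)∕Thm 3.13 is ESTIMATED here;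
«uniform in k» is the provenance statement «`(εC, R′, C₄)` are closed terms in the displayed letters' constants».  (R1)∕(R2) OPEN (the (R2) letter `Prop4UniformAtRecord` is reached from
named displayed letters, not inhabited outright); K0ᴬ ⟨stmt-QuantumFields-27238⟩ NOT closed; K0ᴬ∕K1ᴬ∕K3ᴬ 0∕3; NODE O 0∕1; COUNT 8∕28 · K 1∕4 UNMOVED; finite `𝕋⁴_{L^K}` at fixed ε —
NOT continuum ∕ ℝ⁴ ∕ OS; **the Yang–Mills mass gap (Clay) is NOT proved by any of this.**  No `sorry`, `instance`, `notation`, `set_option`; standard axioms.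
-/

noncomputable section

open scoped Matrix Matrix.Norms.L2Operator InnerProductSpace ComplexConjugate BigOperators

namespace Summit.QuantumFields.YangMills.Theorems.Prop4UniformAtRecord

open Literature.MathematicalPhysics.QuantumFieldTheory.Balaban1983to89
open T4Continuum
open B9SectCLatticeCarrier (Bond)
open B9Eq310DeltaPrime (plaqHolU)
open B11Eq111FrakG (nabla115)
open B11Eq103H1Complex (SiteL2K BondL2K)
open B11Eq115Space (NegSup NegSize Space115 levWeight)
open B11Eq90V0primeCurrent (flat115)
open B11Eq174Chart (Regime)
open B11Prop6Scheme (Prop4Hyp)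
open B13Contraction113 (QuadAnalytic)
open B11Eq118RegimeRadiiUniform (regime_explicit radius_pos)
open Node00
open Summit.QuantumFields.YangMills.Theorems.N07DeltaPiOfRecordPairing (DeltaPiCurOfRecord_pairSum_comm)
open Summit.QuantumFields.YangMills.Theorems.Prop4V0AtRecord (curV0AtRecord_quadBound norm_tauRecCLM_le norm_rhoRec_apply_le)

/-! ## §1  GENERIC: a numeric majorant of def-Y's constant `c4OfLetters ρ τ …` under pointwise bounds of the two slot maps -/

section Generic

variable {𝔸 : Type*} [NormedRing 𝔸] [NormedAlgebra ℂ 𝔸]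

/-- **`c4OfLetters ρ τ …` is dominated by the same polynomial with `‖ρ‖, ‖τ‖ ↦ Mρ, Mτ`** under pointwise bounds `‖ρ ℓ‖ ≤ Mρ‖ℓ‖`, `‖τ X‖ ≤ Mτ‖X‖` (all letter constants
nonneg).  Generic over the fibre algebra, so that the record instance needs no operator norm of `rhoRec`. [cite: Balaban1985Variational, Prop. 4 p.293 (bookkeeping)] -/
theorem c4OfLetters_le_of_bounds (ρ : (𝔸 →L[ℂ] ℂ) →L[ℂ] 𝔸) (τ : 𝔸 →L[ℂ] ℂ) {Mρ Mτ nJ b C₂ εC aC CV R' θ₃ θE θE' N₁ : ℝ}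
    (hMρ : 0 ≤ Mρ) (hρ : ∀ ℓ, ‖ρ ℓ‖ ≤ Mρ * ‖ℓ‖) (hMτ : 0 ≤ Mτ) (hτ : ∀ X, ‖τ X‖ ≤ Mτ * ‖X‖)
    (hnJ : 0 ≤ nJ) (hCV : 0 ≤ CV) (hR' : 0 ≤ R') (hθ₃ : 0 ≤ θ₃) (hθE : 0 ≤ θE) (hθE' : 0 ≤ θE') (hN₁ : 0 ≤ N₁) (hC₂ : 0 ≤ C₂) :
    c4OfLetters ρ τ nJ b C₂ εC aC CV R' θ₃ θE θE' N₁ ≤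
      (Mρ * Mτ * θ₃ * nJ + (N₁ * C₂ * (1 / (1 - 4 * b * C₂ * (εC + aC))) ^ 2 + Mρ * Mτ * θE')
        + Mρ * Mτ * θE * (N₁ * C₂ * (1 / (1 - 4 * b * C₂ * (εC + aC))) ^ 2) * R'
        + Mρ * Mτ * (1 + θE * R') * CV * (1 / (1 - 4 * b * C₂ * (εC + aC))) ^ 2) := by
  unfold c4OfLetters
  have hρn : ‖ρ‖ ≤ Mρ := ContinuousLinearMap.opNorm_le_bound ρ hMρ hρ
  have hτn : ‖τ‖ ≤ Mτ := ContinuousLinearMap.opNorm_le_bound τ hMτ hτ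
  have hρ0 : 0 ≤ ‖ρ‖ := ContinuousLinearMap.opNorm_nonneg ρ
  have hτ0 : 0 ≤ ‖τ‖ := ContinuousLinearMap.opNorm_nonneg τ
  have hℓ0 : 0 ≤ (1 / (1 - 4 * b * C₂ * (εC + aC))) ^ 2 := sq_nonneg _
  have hNC : 0 ≤ N₁ * C₂ * (1 / (1 - 4 * b * C₂ * (εC + aC))) ^ 2 := by positivity
  gcongr

end Generic

/-! ## §2  AT THE RECORD: the letters (ℓc), (ℓb), the scalars, the numeric constant -/

section Record

variable (F : T4Family) (N : ℕ) [NeZero N] (K k : ℕ) (Ω : ℕ → Set (Site (F.P K) 0)) (U₀ : GaugeField (F.P K) 0 (SU N))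
variable [Fact (0 < (F.L : ℝ))] [Fact (0 < (F.P K).eta k)] [Fact (0 < c0Rec F K k)] [Fact (∀ c, 0 < wBRec F K k c)]

omit [NeZero N] [Fact (∀ c, 0 < wBRec F K k c)] in
/-- ★ **(ℓc) `Prop4LetterSymmAtRecord` HOLDS OUTRIGHT** — every background, any `G′`: the (27)-symmetry of `Δπ := DeltaPiCurOfRecord … Gp Q′♭` in the raw-sum spelling, from ✓N07
`DeltaPiCurOfRecord_pairSum_comm` (`η^d ≠ 0` cancelled). [cite: Balaban1985Variational, (27) p.282, (80) p.290; Balaban1985BackgroundPropagators, (3.119) p.419] -/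
theorem prop4LetterSymmAtRecord_holds
    (Gp : SiteL2K ℂ (F.P K).d (fun _ => (F.P K).sitesPerDir 0) (c0Rec F K k) (WRec N) →ₗ[ℂ]
      SiteL2K ℂ (F.P K).d (fun _ => (F.P K).sitesPerDir 0) (c0Rec F K k) (WRec N)) :
    Prop4LetterSymmAtRecord F N K k Ω U₀ Gp := by
  intro Y₁ Y₂
  have hη : ((((F.P K).eta k : ℝ) : ℂ)) ^ (F.P K).d ≠ 0 :=
    pow_ne_zero _ (Complex.ofReal_ne_zero.2 (ne_of_gt (Fact.out : 0 < (F.P K).eta k)))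
  exact mul_left_cancel₀ hη (DeltaPiCurOfRecord_pairSum_comm F N k U₀ Ω Gp (QflatOfRecord F N k) Y₁ Y₂)

omit [Fact (0 < c0Rec F K k)] [Fact (∀ c, 0 < wBRec F K k c)] in
/-- ★ **(ℓb) `Prop4LetterV0AtRecord F N K k Ω U₀ CV (1∕16)` FROM THE SMALL-FIELD WINDOW AND THE WEIGHT PROFILE**, `CV = (1024(d−1)(ωΩ)³·N·(αω² + 1∕16) +
(d−1)(ωΩ)³(136 + 2ωΩ)·N)` a closed term (✓`Prop4V0AtRecord.curV0AtRecord_quadBound`: τ-rescaling of lit's lattice-uniform V₀ bound, `‖tr‖ ≤ N`, `ρ` a contraction, `SU(N) ⊂ U1`).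
DISPLAYED: `‖U₀(∂p) − 1‖ ≤ αη²` on lit's bonds (print's domain (2)∕(14)) and `ω ≥ w̄`, `Ω ≥ w̲⁻¹` of the level weights.
[cite: Balaban1985Variational, (90)–(96) pp.291–292, (98) p.293; Balaban1985BackgroundPropagators, (3.35) p.396] -/
theorem prop4LetterV0AtRecord_of_window {α ω Ωw : ℝ} (hα : 0 ≤ α)
    (hpl : ∀ p : B9SectCLatticeCarrier.Plaq (F.P K).d (fun _ => (F.P K).sitesPerDir 0),
      ‖(plaqHolU (unitsOfRecord F N U₀) p : Matrix (Fin N) (Fin N) ℂ) - 1‖ ≤ α * (F.P K).eta k ^ 2)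
    (hω1 : 1 ≤ ω) (hΩ1 : 1 ≤ Ωw) (hω : (NegSup.wSup (levWeight (F.L : ℝ) ((F.P K).eta k) (bondLevLit F Ω k) 1) : ℝ) ≤ ω)
    (hΩ₀ : (NegSup.wInvSup (levWeight (F.L : ℝ) ((F.P K).eta k) (bondLevLit F Ω k) 1) : ℝ) ≤ Ωw)
    (hΩ₁ : (NegSup.wInvSup (levWeight (F.L : ℝ) ((F.P K).eta k) (pairLevLit F Ω k) 2) : ℝ) ≤ Ωw) :
    Prop4LetterV0AtRecord F N K k Ω U₀
      (1024 * (((F.P K).d - 1 : ℕ) : ℝ) * (ω * Ωw) ^ 3 * N * (α * ω ^ 2 + 1 / 16)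
        + (((F.P K).d - 1 : ℕ) : ℝ) * (ω * Ωw) ^ 3 * (136 + 2 * (ω * Ωw)) * N) (1 / 16) := by
  have hd0 : 0 ≤ (((F.P K).d - 1 : ℕ) : ℝ) := Nat.cast_nonneg _
  have hωΩ : 0 ≤ ω * Ωw := by nlinarith
  refine ⟨by positivity, fun Y hY => ?_⟩
  convert curV0AtRecord_quadBound F N k Ω U₀ hα hpl hω1 hΩ1 hω hΩ₀ hΩ₁ Y hY using 2

omit [NeZero N] [Fact (0 < (F.L : ℝ))] [Fact (0 < (F.P K).eta k)] [Fact (0 < c0Rec F K k)] [Fact (∀ c, 0 < wBRec F K k c)] in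
/-- ★ **THE SCALAR LETTER `Prop4LetterNum` IN CLOSED FORM**: with `r := min (c₄∕4) (min ½ (1∕(16(bC₂+1))))` (✓`regime_explicit` at `δ := 1`, `j := 0`) and
`R′ := min r ((1 − 4bC₂(r + r))·RV)`, `Prop4LetterNum b C₂ c₄ r r RV R′` holds for every `b, C₂ ≥ 0`, `c₄, RV > 0` — print's «for ε₁ sufficiently small» with thresholds in the constants only.
[cite: Balaban1985Variational, Prop. 6 (118), (121) p.295, (46) p.285] -/
theorem prop4LetterNum_explicit {b C₂ c₄ RV : ℝ} (hb : 0 ≤ b) (hC₂ : 0 ≤ C₂) (hc₄ : 0 < c₄) (hRV : 0 < RV) :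
    letI r : ℝ := min (c₄ / 4) (min (1 / 2) (1 / (16 * (b * C₂ + 1))))
    Prop4LetterNum b C₂ c₄ r r RV (min r ((1 - 4 * b * C₂ * (r + r)) * RV)) := by
  set r : ℝ := min (c₄ / 4) (min (1 / 2) (1 / (16 * (b * C₂ + 1)))) with hr
  have hr0 : 0 < r := radius_pos hb hC₂ hc₄ one_pos
  -- `regime_explicit` on the scalar space `ℂ →L[ℂ] ℂ` with the zero map gives the three inequalities of the Sect. C regime at `(r, r)`
  have Rg : Regime (0 : ℂ →L[ℂ] ℂ) 0 (fun _ : ℂ => (0 : ℂ)) b 0 C₂ c₄ 0 r r :=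
    regime_explicit (δ := 1) hb hC₂ hc₄ one_pos (0 : ℂ →L[ℂ] ℂ) (fun f => by simp; positivity)
      ⟨fun Y _ => by simp; positivity, fun P Q => differentiableOn_const (0 : ℂ)⟩ (j := 0)
      (by have := radius_pos hb hC₂ hc₄ one_pos; positivity)
  have hdom : 2 * (r + r) ≤ c₄ := Rg.dom
  have hself : b * C₂ * (r + r) ^ 2 ≤ r := by have := Rg.self; linarith
  have hcontr : 4 * b * C₂ * (r + r) < 1 := by have := Rg.contr; linarith
  refine ⟨hb, hC₂, hr0.le, hdom, hself, hcontr, le_min hr0.le (mul_nonneg (by linarith) hRV.le), min_le_left _ _, min_le_right _ _⟩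

omit [NeZero N] [Fact (0 < (F.L : ℝ))] [Fact (0 < (F.P K).eta k)] [Fact (0 < c0Rec F K k)] [Fact (∀ c, 0 < wBRec F K k c)] in
/-- ★ **THE NUMERIC, k-FREE MAJORANT OF def-Y's CONSTANT `c4OfRecord N nJ …`** (which carries `‖rhoRec N‖·‖tauRecCLM N‖`): `≤` the same polynomial with `1·N` in their place
(`‖ρ ℓ‖ ≤ ‖ℓ‖` ✓`norm_rhoRec_apply_le`, `‖tr X‖ ≤ N‖X‖` ✓`norm_tauRecCLM_le`). [cite: Balaban1985Variational, Prop. 4 p.293 («C₄ depend on d and L only»)] -/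
theorem c4OfRecord_le_numeric {nJ b C₂ εC aC CV R' θ₃ θE θE' N₁ : ℝ}
    (hnJ : 0 ≤ nJ) (hCV : 0 ≤ CV) (hR' : 0 ≤ R') (hθ₃ : 0 ≤ θ₃) (hθE : 0 ≤ θE) (hθE' : 0 ≤ θE') (hN₁ : 0 ≤ N₁) (hC₂ : 0 ≤ C₂) :
    c4OfRecord N nJ b C₂ εC aC CV R' θ₃ θE θE' N₁ ≤
      (N * θ₃ * nJ + (N₁ * C₂ * (1 / (1 - 4 * b * C₂ * (εC + aC))) ^ 2 + N * θE')
        + N * θE * (N₁ * C₂ * (1 / (1 - 4 * b * C₂ * (εC + aC))) ^ 2) * R'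
        + N * (1 + θE * R') * CV * (1 / (1 - 4 * b * C₂ * (εC + aC))) ^ 2) := by
  have h := c4OfLetters_le_of_bounds (rhoRec N) (tauRecCLM N) (εC := εC) (aC := aC) (b := b) (C₂ := C₂) (N₁ := N₁) zero_le_one
    (fun ℓ => by rw [one_mul]; exact norm_rhoRec_apply_le N ℓ) (Nat.cast_nonneg N) (norm_tauRecCLM_le N) hnJ hCV hR' hθ₃ hθE hθE' hN₁ hC₂
  simpa only [c4OfRecord, one_mul] using h

/-! ## §3  THE DOOR: `Prop4UniformAtRecord` from (ℓa-H), (ℓa-C), (ℓd), the small-field window, the weight profile and a bound of `‖J‖` — everything else discharged -/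

/-- ★★★ **THE (R2) DOOR — [B11] PROP. 4 (97)–(98) FOR THE RECORD'S `W`, «uniform in k» BY PROVENANCE.**  GIVEN the displayed letters (ℓa-H) `Prop4LetterHAtRecord … b`
((46)∕(117): `‖H₁♭ X‖ ≤ b‖X‖`, [B9] Thm 3.13 class), (ℓa-C) `Prop4LetterCAtRecord … C₂ c₄` ((44) on the traceless slice + Sect. G analyticity), print's small-field window
`‖U₀(∂p) − 1‖ ≤ αη²` with the level-weight profile `(ω, Ω)`, (ℓd) `Prop4LetterColumnsAtRecord …` at `εC := r` on the radius `R′` ([B9] (3.132)∕(55)∕(73) kernel columns) and a bound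
`‖J(U₀)‖₍₋₃₎ ≤ nJ` ((28); ✓`Node00.norm_JOfRecordAtBg_le` gives `nJ = C₁B₃ε₁` under the (14) window) — THEN `Prop4UniformAtRecord F N K k Ω U₀ levB a hpos hQ r Gp C₄ R′` with
`εC = aC := r = min (c₄∕4) (min ½ (1∕(16(bC₂+1))))`, `R′ = min r ((1 − 4bC₂(r + r))∕16)`, `C₄ = c4OfRecord N nJ b C₂ r r CV R′ θ₃ θE θE′ N₁`, `CV = 1024(d−1)(ωΩ)³N(αω² + 1∕16) +
(d−1)(ωΩ)³(136 + 2ωΩ)N` — ALL CLOSED TERMS in the letters' constants.  Discharged on the way: (ℓc) symmetry (§2), (ℓb) V₀ (§2 ∕ ✓`Prop4V0AtRecord`), the scalars (§2), via def-Y's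
✓`prop4UniformAtRecord_of_letters_of_norm_J_le`.  HONEST: an assembly; (ℓa-H), (ℓa-C), (ℓd) are NOT proved here. [cite: Balaban1985Variational, Prop. 4 (97)–(98) pp.292–293] -/
theorem prop4UniformAtRecord_of_recordLetters (levB : PBond (F.P K) k → ℕ) (a : ℝ)
    (hpos : ∀ x, x ≠ 0 → 0 < RCLike.re ⟪x, laplaceAOfRecord F N k U₀ (QOfRecord F N k U₀) (QflatOfRecord F N k) a x⟫_ℂ)
    (hQ : Function.Surjective (QOfRecord F N k U₀))
    (Gp : SiteL2K ℂ (F.P K).d (fun _ => (F.P K).sitesPerDir 0) (c0Rec F K k) (WRec N) →ₗ[ℂ]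
      SiteL2K ℂ (F.P K).d (fun _ => (F.P K).sitesPerDir 0) (c0Rec F K k) (WRec N))
    {b C₂ c₄ α ω Ωw θ₃ θE θE' N₁ nJ : ℝ} (hb : 0 ≤ b) (hC₂ : 0 ≤ C₂) (hc₄ : 0 < c₄)
    (hH : Prop4LetterHAtRecord F N K k Ω U₀ levB a hpos hQ b) (hC : Prop4LetterCAtRecord F N K k Ω U₀ levB C₂ c₄)
    (hα : 0 ≤ α)
    (hpl : ∀ p : B9SectCLatticeCarrier.Plaq (F.P K).d (fun _ => (F.P K).sitesPerDir 0),
      ‖(plaqHolU (unitsOfRecord F N U₀) p : Matrix (Fin N) (Fin N) ℂ) - 1‖ ≤ α * (F.P K).eta k ^ 2)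
    (hω1 : 1 ≤ ω) (hΩ1 : 1 ≤ Ωw) (hω : (NegSup.wSup (levWeight (F.L : ℝ) ((F.P K).eta k) (bondLevLit F Ω k) 1) : ℝ) ≤ ω)
    (hΩ₀ : (NegSup.wInvSup (levWeight (F.L : ℝ) ((F.P K).eta k) (bondLevLit F Ω k) 1) : ℝ) ≤ Ωw)
    (hΩ₁ : (NegSup.wInvSup (levWeight (F.L : ℝ) ((F.P K).eta k) (pairLevLit F Ω k) 2) : ℝ) ≤ Ωw)
    (hcol : letI r : ℝ := min (c₄ / 4) (min (1 / 2) (1 / (16 * (b * C₂ + 1))))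
      Prop4LetterColumnsAtRecord F N K k Ω U₀ levB a hpos hQ r Gp (min r ((1 - 4 * b * C₂ * (r + r)) * (1 / 16))) θ₃ θE θE' N₁)
    (hJ : ‖JOfRecordAtBg F N K k Ω U₀‖ ≤ nJ) :
    letI r : ℝ := min (c₄ / 4) (min (1 / 2) (1 / (16 * (b * C₂ + 1))))
    letI R' : ℝ := min r ((1 - 4 * b * C₂ * (r + r)) * (1 / 16))
    letI CV : ℝ := 1024 * (((F.P K).d - 1 : ℕ) : ℝ) * (ω * Ωw) ^ 3 * N * (α * ω ^ 2 + 1 / 16)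
        + (((F.P K).d - 1 : ℕ) : ℝ) * (ω * Ωw) ^ 3 * (136 + 2 * (ω * Ωw)) * N
    Prop4UniformAtRecord F N K k Ω U₀ levB a hpos hQ r Gp (c4OfRecord N nJ b C₂ r r CV R' θ₃ θE θE' N₁) R' :=
  prop4UniformAtRecord_of_letters_of_norm_J_le F N K k Ω U₀ levB a hpos hQ Gp hH hC (prop4LetterNum_explicit hb hC₂ hc₄ (by norm_num))
    (prop4LetterV0AtRecord_of_window F N K k Ω U₀ hα hpl hω1 hΩ1 hω hΩ₀ hΩ₁) (prop4LetterSymmAtRecord_holds F N K k Ω U₀ Gp) hcol hJ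

/-- ★★★ **THE SAME WITH A PURELY NUMERIC CONSTANT** (def-Y's `c4OfRecord` carries `‖rhoRec N‖·‖tauRecCLM N‖`; here they are replaced by `1·N`, ✓`c4OfRecord_le_numeric` +
✓`prop4UniformAtRecord_mono`): `C₄ = Nθ₃nJ + (N₁C₂ℓ² + NθE′) + NθE·N₁C₂ℓ²·R′ + N(1 + θER′)CVℓ²`, `ℓ = (1 − 4bC₂(r+r))⁻¹` — a polynomial in `N, d, b, C₂, c₄, α, ω, Ω, θ₃, θE, θE′, N₁,
nJ` and nothing else: print's «The constants a₃, C₄ depend on d and L only» AS PROVENANCE, given k-free letters. [cite: Balaban1985Variational, Prop. 4 (97)–(98) pp.292–293] -/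
theorem prop4UniformAtRecord_of_recordLetters_numeric (levB : PBond (F.P K) k → ℕ) (a : ℝ)
    (hpos : ∀ x, x ≠ 0 → 0 < RCLike.re ⟪x, laplaceAOfRecord F N k U₀ (QOfRecord F N k U₀) (QflatOfRecord F N k) a x⟫_ℂ)
    (hQ : Function.Surjective (QOfRecord F N k U₀))
    (Gp : SiteL2K ℂ (F.P K).d (fun _ => (F.P K).sitesPerDir 0) (c0Rec F K k) (WRec N) →ₗ[ℂ]
      SiteL2K ℂ (F.P K).d (fun _ => (F.P K).sitesPerDir 0) (c0Rec F K k) (WRec N))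
    {b C₂ c₄ α ω Ωw θ₃ θE θE' N₁ nJ : ℝ} (hb : 0 ≤ b) (hC₂ : 0 ≤ C₂) (hc₄ : 0 < c₄)
    (hH : Prop4LetterHAtRecord F N K k Ω U₀ levB a hpos hQ b) (hC : Prop4LetterCAtRecord F N K k Ω U₀ levB C₂ c₄)
    (hα : 0 ≤ α)
    (hpl : ∀ p : B9SectCLatticeCarrier.Plaq (F.P K).d (fun _ => (F.P K).sitesPerDir 0),
      ‖(plaqHolU (unitsOfRecord F N U₀) p : Matrix (Fin N) (Fin N) ℂ) - 1‖ ≤ α * (F.P K).eta k ^ 2)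
    (hω1 : 1 ≤ ω) (hΩ1 : 1 ≤ Ωw) (hω : (NegSup.wSup (levWeight (F.L : ℝ) ((F.P K).eta k) (bondLevLit F Ω k) 1) : ℝ) ≤ ω)
    (hΩ₀ : (NegSup.wInvSup (levWeight (F.L : ℝ) ((F.P K).eta k) (bondLevLit F Ω k) 1) : ℝ) ≤ Ωw)
    (hΩ₁ : (NegSup.wInvSup (levWeight (F.L : ℝ) ((F.P K).eta k) (pairLevLit F Ω k) 2) : ℝ) ≤ Ωw)
    (hcol : letI r : ℝ := min (c₄ / 4) (min (1 / 2) (1 / (16 * (b * C₂ + 1))))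
      Prop4LetterColumnsAtRecord F N K k Ω U₀ levB a hpos hQ r Gp (min r ((1 - 4 * b * C₂ * (r + r)) * (1 / 16))) θ₃ θE θE' N₁)
    (hJ : ‖JOfRecordAtBg F N K k Ω U₀‖ ≤ nJ) :
    letI r : ℝ := min (c₄ / 4) (min (1 / 2) (1 / (16 * (b * C₂ + 1))))
    letI R' : ℝ := min r ((1 - 4 * b * C₂ * (r + r)) * (1 / 16))
    letI CV : ℝ := 1024 * (((F.P K).d - 1 : ℕ) : ℝ) * (ω * Ωw) ^ 3 * N * (α * ω ^ 2 + 1 / 16)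
        + (((F.P K).d - 1 : ℕ) : ℝ) * (ω * Ωw) ^ 3 * (136 + 2 * (ω * Ωw)) * N
    Prop4UniformAtRecord F N K k Ω U₀ levB a hpos hQ r Gp
      ((N * θ₃ * nJ + (N₁ * C₂ * (1 / (1 - 4 * b * C₂ * (r + r))) ^ 2 + N * θE')
        + N * θE * (N₁ * C₂ * (1 / (1 - 4 * b * C₂ * (r + r))) ^ 2) * R'
        + N * (1 + θE * R') * CV * (1 / (1 - 4 * b * C₂ * (r + r))) ^ 2)) R' := by
  have hmain := prop4UniformAtRecord_of_recordLetters F N K k Ω U₀ levB a hpos hQ Gp hb hC₂ hc₄ hH hC hα hpl hω1 hΩ1 hω hΩ₀ hΩ₁ hcol hJ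
  have hnum := prop4LetterNum_explicit (b := b) (C₂ := C₂) hb hC₂ hc₄ (by norm_num : (0 : ℝ) < 1 / 16)
  obtain ⟨⟨hθ₃, hθE, hθE', hN₁⟩, -⟩ := hcol
  have hCV := (prop4LetterV0AtRecord_of_window F N K k Ω U₀ hα hpl hω1 hΩ1 hω hΩ₀ hΩ₁).1
  exact prop4UniformAtRecord_mono F N K k Ω U₀ levB a hpos hQ _ Gp hmain
    (c4OfRecord_le_numeric N ((norm_nonneg _).trans hJ) hCV hnum.2.2.2.2.2.2.1 hθ₃ hθE hθE' hN₁ hC₂)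

/-! ## §4  The door at print's (14) current window: `nJ := C₁B₃ε₁` (✓`Node00.norm_JOfRecordAtBg_le`) -/

/-- ★★★ **THE DOOR AT THE (14) WINDOW** — `prop4UniformAtRecord_of_recordLetters_numeric` with the `‖J‖`-bound supplied by print's current clause of `U₀ ∈ 𝔘_k({Ω_j}, C₁B₃ε₁)`
read bondwise (lit `InU2cur`, ✓`Node00.norm_JOfRecordAtBg_le`): the whole antecedent is now (ℓa-H), (ℓa-C), (ℓd) + DOMAIN CLAUSES of print (plaquette window, current window) + the
level-weight profile — no free numeric letter besides the constants. [cite: Balaban1985Variational, (2) p.278, (14) p.280, (28) p.282, Prop. 4 (97)–(98) pp.292–293] -/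
theorem prop4UniformAtRecord_of_recordLetters_window (levB : PBond (F.P K) k → ℕ) (a : ℝ)
    (hpos : ∀ x, x ≠ 0 → 0 < RCLike.re ⟪x, laplaceAOfRecord F N k U₀ (QOfRecord F N k U₀) (QflatOfRecord F N k) a x⟫_ℂ)
    (hQ : Function.Surjective (QOfRecord F N k U₀))
    (Gp : SiteL2K ℂ (F.P K).d (fun _ => (F.P K).sitesPerDir 0) (c0Rec F K k) (WRec N) →ₗ[ℂ]
      SiteL2K ℂ (F.P K).d (fun _ => (F.P K).sitesPerDir 0) (c0Rec F K k) (WRec N))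
    {b C₂ c₄ α ω Ωw θ₃ θE θE' N₁ C₁ B₃ ε₁ : ℝ} (hb : 0 ≤ b) (hC₂ : 0 ≤ C₂) (hc₄ : 0 < c₄)
    (hH : Prop4LetterHAtRecord F N K k Ω U₀ levB a hpos hQ b) (hC : Prop4LetterCAtRecord F N K k Ω U₀ levB C₂ c₄)
    (hα : 0 ≤ α)
    (hpl : ∀ p : B9SectCLatticeCarrier.Plaq (F.P K).d (fun _ => (F.P K).sitesPerDir 0),
      ‖(plaqHolU (unitsOfRecord F N U₀) p : Matrix (Fin N) (Fin N) ℂ) - 1‖ ≤ α * (F.P K).eta k ^ 2)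
    (hK : 0 ≤ C₁ * B₃ * ε₁) (h14 : B11Prop6Concrete.InU2cur (F.L : ℝ) ((F.P K).eta k) (bondLevLit F Ω k) (C₁ * B₃ * ε₁) (unitsOfRecord F N U₀))
    (hω1 : 1 ≤ ω) (hΩ1 : 1 ≤ Ωw) (hω : (NegSup.wSup (levWeight (F.L : ℝ) ((F.P K).eta k) (bondLevLit F Ω k) 1) : ℝ) ≤ ω)
    (hΩ₀ : (NegSup.wInvSup (levWeight (F.L : ℝ) ((F.P K).eta k) (bondLevLit F Ω k) 1) : ℝ) ≤ Ωw)
    (hΩ₁ : (NegSup.wInvSup (levWeight (F.L : ℝ) ((F.P K).eta k) (pairLevLit F Ω k) 2) : ℝ) ≤ Ωw)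
    (hcol : letI r : ℝ := min (c₄ / 4) (min (1 / 2) (1 / (16 * (b * C₂ + 1))))
      Prop4LetterColumnsAtRecord F N K k Ω U₀ levB a hpos hQ r Gp (min r ((1 - 4 * b * C₂ * (r + r)) * (1 / 16))) θ₃ θE θE' N₁) :
    letI r : ℝ := min (c₄ / 4) (min (1 / 2) (1 / (16 * (b * C₂ + 1))))
    letI R' : ℝ := min r ((1 - 4 * b * C₂ * (r + r)) * (1 / 16))
    letI CV : ℝ := 1024 * (((F.P K).d - 1 : ℕ) : ℝ) * (ω * Ωw) ^ 3 * N * (α * ω ^ 2 + 1 / 16)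
        + (((F.P K).d - 1 : ℕ) : ℝ) * (ω * Ωw) ^ 3 * (136 + 2 * (ω * Ωw)) * N
    Prop4UniformAtRecord F N K k Ω U₀ levB a hpos hQ r Gp
      ((N * θ₃ * (C₁ * B₃ * ε₁) + (N₁ * C₂ * (1 / (1 - 4 * b * C₂ * (r + r))) ^ 2 + N * θE')
        + N * θE * (N₁ * C₂ * (1 / (1 - 4 * b * C₂ * (r + r))) ^ 2) * R'
        + N * (1 + θE * R') * CV * (1 / (1 - 4 * b * C₂ * (r + r))) ^ 2)) R' :=
  prop4UniformAtRecord_of_recordLetters_numeric F N K k Ω U₀ levB a hpos hQ Gp hb hC₂ hc₄ hH hC hα hpl hω1 hΩ1 hω hΩ₀ hΩ₁ hcol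
    (norm_JOfRecordAtBg_le (F := F) (N := N) (k := k) (Ω := Ω) (U₀ := U₀) hK h14)

end Record

end Summit.QuantumFields.YangMills.Theorems.Prop4UniformAtRecord

end
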